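import Mathlib.Analysis.InnerProductSpace.PiL2
import Mathlib.Analysis.Distribution.TemperedDistribution
import Literature.Analysis.FluidPDE.ClassicalSolution
import Literature.Analysis.FluidPDE.LerayHopf
import Literature.Analysis.FluidPDE.NSWave0
import Literature.Analysis.FluidPDE.CriticalRegularity
import HarnessLib

/-!
# Named facts: critical-norm continuation criteria for classical Leray–Hopf solutions

Grounder file (D-0014 named facts) for the route `NavierStokesRegularity/MonotoneCritical`
(items #3 and #5, stmt-NavierStokesRegularity-0063 / 0065): the two "closure" statements turning
boundedness of a critical norm on `[0, T)` into smooth continuation past `T`, for classical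
finite-energy solutions from rapidly decaying data.

* `L³`: Escauriaza–Seregin–Šverák (Russ. Math. Surveys 58 (2003), Thms. 1.3–1.4): an
  `L^∞(0,T; L³)` Leray–Hopf solution is smooth, and if `T` is a blow-up time then
  `limsup_{t↑T} ‖u(t)‖_{L³} = ∞`; Seregin (Comm. Math. Phys. 312 (2012), Thm. 1.1) upgrades to
  `lim`. Contrapositive: `sup_{[0,T)} ‖u(t)‖₃ < ∞` ⇒ no blow-up at `T` ⇒ smooth extension past `T`
  (local strong continuation from `u(T) ∈ L³ ∩ L²`, Kato 1984). In-tree relatives: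
  `Literature.Analysis.FluidPDE.ess_endpoint`, `Literature.Analysis.FluidPDE.seregin_L3_blowup` (facts).
* Besov `Ḃ^{-1+3/r}_{r,q}`, `3 < r, q < ∞`: Gallagher–Koch–Planchon (Comm. Math. Phys. 343
  (2016), Thm. 1 / Cor.): the critical Besov norm has `limsup = ∞` at a singular time (Albritton,
  Anal. PDE 11 (2018): `lim`). Contrapositive as above. In-tree relative: the (sorried) theorem
  `Literature.Analysis.FluidPDE.gkp_besov_blowup` in `CriticalRegularity.lean`.

Nothing is asserted; users take `(h : <name>)`.

## References

* L. Escauriaza, G. Seregin, V. Šverák, *`L_{3,∞}`-solutions of Navier–Stokes equations and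
  backward uniqueness*, Russ. Math. Surveys 58 (2003), 211–250, Thms. 1.3–1.4.
* G. Seregin, Comm. Math. Phys. 312 (2012), 833–845, Thm. 1.1.
* I. Gallagher, G. Koch, F. Planchon, Comm. Math. Phys. 343 (2016), 39–82, Thm. 1.
* D. Albritton, Anal. PDE 11 (2018), 1415–1456.
-/

noncomputable section

open MeasureTheory Set

namespace Literature.Analysis.FluidPDE

/-- NAMED FACT (`L³` continuation criterion; Escauriaza–Seregin–Šverák 2003 Thm. 1.4, Seregin
2012 Thm. 1.1). A classical solution on `ℝ³ × [0, T)` which is Leray–Hopf from a rapidly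
decaying datum and satisfies `sup_{0 ≤ t < T} ‖u(t)‖_{L³} < ∞` extends as a classical solution
past `T`. Users take `(h : hasSmoothExtensionPast_of_eLpNorm_three_bounded)`. [cite: Seregin2012, Thm. 1.1 (with EscauriazaSereginSverak2003 Thm. 1.4)] -/
def hasSmoothExtensionPast_of_eLpNorm_three_bounded : Prop :=
  ∀ (ν T : ℝ), 0 < ν → 0 < T →
    ∀ (u : ℝ → EuclideanSpace ℝ (Fin 3) → EuclideanSpace ℝ (Fin 3))
      (p : ℝ → EuclideanSpace ℝ (Fin 3) → ℝ),
      FluidPDE.IsClassicalNSSolutionOn (Ico 0 T) ν 0 u p → FluidPDE.IsLerayHopfOn T ν 0 (u 0) u →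
        HasRapidSpatialDecay (u 0) → (⨆ t ∈ Ico 0 T, eLpNorm (u t) 3 volume) < ⊤ →
          FluidPDE.HasSmoothExtensionPast ν 0 u T

/-- NAMED FACT (critical Besov continuation criterion; Gallagher–Koch–Planchon 2016 Thm. 1,
Albritton 2018). A classical solution on `ℝ³ × [0, T)` which is Leray–Hopf from a rapidly decaying
datum, whose slices are represented by tempered distributions `U t` with
`sup_{0 ≤ t < T} ‖U t‖_{Ḃ^{-1+3/r}_{r,q}} < ∞` for some `3 < r < ∞`, `3 < q < ∞`, extends as a
classical solution past `T`. Users take `(h : hasSmoothExtensionPast_of_eHomBesovNorm_bounded)`. [cite: GKP2016, Thm. 1] -/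
def hasSmoothExtensionPast_of_eHomBesovNorm_bounded : Prop :=
  ∀ (ν T : ℝ), 0 < ν → 0 < T →
    ∀ (u : ℝ → EuclideanSpace ℝ (Fin 3) → EuclideanSpace ℝ (Fin 3))
      (p : ℝ → EuclideanSpace ℝ (Fin 3) → ℝ)
      (U : ℝ → TemperedDistribution (EuclideanSpace ℝ (Fin 3)) (EuclideanSpace ℂ (Fin 3)))
      (r q : ENNReal) [Fact (1 ≤ r)], 3 < r → r < ⊤ → 3 < q → q < ⊤ →
      FluidPDE.IsClassicalNSSolutionOn (Ico 0 T) ν 0 u p → FluidPDE.IsLerayHopfOn T ν 0 (u 0) u →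
        HasRapidSpatialDecay (u 0) → (∀ t ∈ Ico 0 T, IsDistributionOf (u t) (U t)) →
          (⨆ t ∈ Ico 0 T, FunctionSpaces.eHomBesovNorm (-1 + 3 / r.toReal) r q (U t)) < ⊤ →
            FluidPDE.HasSmoothExtensionPast ν 0 u T

end Literature.Analysis.FluidPDE

end
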